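import Literature.MathematicalPhysics.QuantumFieldTheory.LatticeGaugeProofs

/-!
# Boxes on the discrete torus and locality of the Wilson action

Helper for stub `stub_spreadFromParts` (S6) of line `free-volume-heavy-witness`
(crux `Summit.QuantumFields.QCD.Theses.SpectralDefectExtinction.WindowExtinction`,
item stmt-QuantumFields-8964).  Tree vocabulary only (`box`, `Torus.proj`, `wilsonAction`).

* `spread_proj_add_injective` — for `2R+1 ≤ n` the box `c + {-R,…,R}^d ⊂ ℤ^d` embeds in the
  torus `(ℤ/n)^d` under `Torus.proj n`.
* `spread_proj_add_sub_ne` — if `c₁` and every periodic image of `c₂` are at sup-distance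
  `≥ 2R+1+D` (the line's `TorusSeparated`, inlined), then no point of the image of the box about
  `c₁` is within torus sup-distance `D` of the image of the box about `c₂`; in particular
  (`spread_proj_add_ne`) the two images are disjoint.
* `spread_wilsonAction_mixed_eq_zero` — range-one locality of the Wilson action: its mixed second
  difference under surgeries in two such boxes (`D ≥ 1`) vanishes, because no plaquette has links
  based in both images.
-/

noncomputable section

namespace Summit.QuantumFields.QCD.Cruxes.WindowExtinction.FreeVolumeHeavyWitness

open Literature.MathematicalPhysics.QuantumFieldTheory Literature.Probability.LatticeModels
open scoped BigOperators

variable {d : ℕ}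

/-! ## Arithmetic of `Torus.proj` -/

/-- `Torus.proj` is additive. -/
theorem spread_proj_add (n : ℕ) (a b : Fin d → ℤ) :
    Torus.proj n (a + b) = Torus.proj n a + Torus.proj n b := by
  funext k
  simp only [Torus.proj_apply, Pi.add_apply, Int.cast_add]

/-- `Torus.proj` commutes with subtraction. -/
theorem spread_proj_sub (n : ℕ) (a b : Fin d → ℤ) :
    Torus.proj n (a - b) = Torus.proj n a - Torus.proj n b := by
  funext k
  simp only [Torus.proj_apply, Pi.sub_apply, Int.cast_sub]

/-- `Torus.proj` of a unit lattice vector is the unit torus vector. -/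
theorem spread_proj_single (n : ℕ) (i : Fin d) :
    Torus.proj n (Pi.single i (1 : ℤ)) = Pi.single i (1 : ZMod n) := by
  funext k
  simp only [Torus.proj_apply]
  by_cases h : k = i
  · subst h; simp
  · simp [h]

/-- Two lattice points have the same image on the torus of side `n` iff they differ by a multiple
of `n` in every coordinate. -/
theorem spread_proj_eq_iff (n : ℕ) (a b : Fin d → ℤ) :
    Torus.proj n a = Torus.proj n b ↔ ∀ k, (n : ℤ) ∣ a k - b k := by
  constructor
  · intro h k
    have hk : (a k : ZMod n) = (b k : ZMod n) := by
      have := congrFun h k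
      simpa only [Torus.proj_apply] using this
    have := (ZMod.intCast_eq_intCast_iff_dvd_sub (b k) (a k) n).1 hk.symm
    exact this
  · intro h
    funext k
    simp only [Torus.proj_apply]
    exact ((ZMod.intCast_eq_intCast_iff_dvd_sub (b k) (a k) n).2 (h k)).symm

/-! ## Boxes embed and separated boxes are far apart -/

/-- Coordinates of a point of `box d R` are bounded by `R` in absolute value. -/
theorem spread_abs_le_of_mem_box {R : ℕ} {y : Fin d → ℤ} (hy : y ∈ box d R) (k : Fin d) :
    |y k| ≤ R := by
  rw [mem_box] at hy
  exact abs_le.2 ⟨(hy k).1, (hy k).2⟩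

/-- **The box embeds in the torus.** For `2R+1 ≤ n` the map `y ↦ proj n (c + y)` is injective on
`box d R`. -/
theorem spread_proj_add_injective {n R : ℕ} (hn : 2 * R + 1 ≤ n) (c : Fin d → ℤ)
    {y y' : Fin d → ℤ} (hy : y ∈ box d R) (hy' : y' ∈ box d R)
    (h : Torus.proj n (c + y) = Torus.proj n (c + y')) : y = y' := by
  funext k
  have hdvd : (n : ℤ) ∣ y k - y' k := by
    have := (spread_proj_eq_iff n _ _).1 h k
    simpa only [Pi.add_apply, add_sub_add_left_eq_sub] using this
  have habs : |y k - y' k| < n := by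
    have h1 := spread_abs_le_of_mem_box hy k
    have h2 := spread_abs_le_of_mem_box hy' k
    have h3 : |y k - y' k| ≤ |y k| + |y' k| := abs_sub _ _
    have h4 : (2 * R + 1 : ℤ) ≤ n := by exact_mod_cast hn
    linarith
  have := Int.eq_zero_of_abs_lt_dvd hdvd habs
  linarith

/-- **Separated boxes are far apart on the torus.** If `c₁` and every periodic image of `c₂` are at
sup-distance `≥ 2R+1+D`, then for `y, y'` in the box and any lattice vector `e` with
`|e k| ≤ D` for all `k`, `proj (c₁ + y) - proj (c₂ + y') ≠ proj e`. -/
theorem spread_proj_add_sub_ne {n R D : ℕ} {c₁ c₂ : Fin d → ℤ}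
    (hsep : ∀ q : Fin d → ℤ, ∃ j : Fin d, ((2 * R + 1 + D : ℕ) : ℤ) ≤ |c₁ j - c₂ j - q j * n|)
    {y y' : Fin d → ℤ} (hy : y ∈ box d R) (hy' : y' ∈ box d R) {e : Fin d → ℤ}
    (he : ∀ k, |e k| ≤ D) :
    Torus.proj n (c₁ + y) - Torus.proj n (c₂ + y') ≠ Torus.proj n e := by
  intro h
  rw [← spread_proj_sub, spread_proj_eq_iff] at h
  choose q hq using h
  obtain ⟨j, hj⟩ := hsep q
  have hqj := hq j
  simp only [Pi.sub_apply, Pi.add_apply] at hqj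
  have hkey : c₁ j - c₂ j - q j * n = y' j - y j + e j := by linear_combination hqj
  have h1 := spread_abs_le_of_mem_box hy j
  have h2 := spread_abs_le_of_mem_box hy' j
  have h3 := he j
  have h4 : |y' j - y j + e j| ≤ |y' j| + |y j| + |e j| :=
    (abs_add_le _ _).trans (add_le_add (abs_sub _ _) le_rfl)
  have h5 : ((2 * R + 1 + D : ℕ) : ℤ) = 2 * (R : ℤ) + 1 + D := by push_cast; ring
  rw [hkey, h5] at hj
  linarith

/-- **Separated boxes have disjoint images** on the torus. -/
theorem spread_proj_add_ne {n R D : ℕ} {c₁ c₂ : Fin d → ℤ}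
    (hsep : ∀ q : Fin d → ℤ, ∃ j : Fin d, ((2 * R + 1 + D : ℕ) : ℤ) ≤ |c₁ j - c₂ j - q j * n|)
    {y y' : Fin d → ℤ} (hy : y ∈ box d R) (hy' : y' ∈ box d R) :
    Torus.proj n (c₁ + y) ≠ Torus.proj n (c₂ + y') := by
  intro h
  refine spread_proj_add_sub_ne hsep hy hy' (e := 0) (fun k => ?_) ?_
  · simp
  · rw [h, sub_self]
    funext k
    simp [Torus.proj_apply]

/-! ## Range-one locality of the Wilson action -/

section Wilson

variable {n N : ℕ} {G : Type*} [Group G] (ρ : G →* Matrix (Fin N) (Fin N) ℂ)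

/-- The plaquette holonomy reads only the four links of the plaquette. -/
theorem spread_plaquetteHolonomy_congr {V W : GaugeConfig d n G} {x : Site d n} {i j : Fin d}
    (h₁ : V (x, i) = W (x, i)) (h₂ : V (x.shift i, j) = W (x.shift i, j))
    (h₃ : V (x.shift j, i) = W (x.shift j, i)) (h₄ : V (x, j) = W (x, j)) :
    plaquetteHolonomy V x i j = plaquetteHolonomy W x i j := by
  simp only [plaquetteHolonomy, h₁, h₂, h₃, h₄]

/-- **Abstract range-one locality.** Let `P₁, P₂` be two sets of torus sites such that no plaquette
has base sites in both (the three base sites of the plaquette at `x` in the plane `(i, j)` are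
`x, x + eᵢ, x + eⱼ`).  If `U₁` agrees with `U` off `P₁`, `U₂` agrees with `U` off `P₂`, and `U₁₂`
is `U₁` on `P₁` and `U₂` off `P₁` (links are attributed to their base site), then the mixed second
difference of the Wilson action vanishes: `S(U₁₂) - S(U₁) - S(U₂) + S(U) = 0`. -/
theorem spread_wilsonAction_mixed_eq_zero_of_regions [NeZero n] (P₁ P₂ : Site d n → Prop)
    (hP : ∀ (x : Site d n) (i j : Fin d) (a b : Site d n),
      (a = x ∨ a = x.shift i ∨ a = x.shift j) → (b = x ∨ b = x.shift i ∨ b = x.shift j) →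
        P₁ a → P₂ b → False)
    (U U₁ U₂ U₁₂ : GaugeConfig d n G)
    (h1 : ∀ e, ¬ P₁ e.1 → U₁ e = U e) (h2 : ∀ e, ¬ P₂ e.1 → U₂ e = U e)
    (h3 : ∀ e, P₁ e.1 → U₁₂ e = U₁ e) (h4 : ∀ e, ¬ P₁ e.1 → U₁₂ e = U₂ e) :
    wilsonAction ρ U₁₂ - wilsonAction ρ U₁ - wilsonAction ρ U₂ + wilsonAction ρ U = 0 := by
  classical
  unfold wilsonAction
  rw [← Finset.sum_sub_distrib, ← Finset.sum_sub_distrib, ← Finset.sum_add_distrib]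
  refine Finset.sum_eq_zero fun p _ => ?_
  obtain ⟨x, ⟨⟨i, j⟩, hij⟩⟩ := p
  simp only
  -- the values of `U₁₂` off `P₁`
  have h42 : ∀ e, ¬ P₁ e.1 → ¬ P₂ e.1 → U₁₂ e = U₁ e := fun e he he' => by
    rw [h4 e he, h2 e he', h1 e he]
  by_cases hA : P₁ x ∨ P₁ (x.shift i) ∨ P₁ (x.shift j)
  · -- some base site of the plaquette lies in `P₁`: then none lies in `P₂`
    have hB : ¬ P₂ x ∧ ¬ P₂ (x.shift i) ∧ ¬ P₂ (x.shift j) := by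
      rcases hA with ha | ha | ha
      · exact ⟨fun hb => hP x i j _ _ (Or.inl rfl) (Or.inl rfl) ha hb,
          fun hb => hP x i j _ _ (Or.inl rfl) (Or.inr (Or.inl rfl)) ha hb,
          fun hb => hP x i j _ _ (Or.inl rfl) (Or.inr (Or.inr rfl)) ha hb⟩
      · exact ⟨fun hb => hP x i j _ _ (Or.inr (Or.inl rfl)) (Or.inl rfl) ha hb,
          fun hb => hP x i j _ _ (Or.inr (Or.inl rfl)) (Or.inr (Or.inl rfl)) ha hb,
          fun hb => hP x i j _ _ (Or.inr (Or.inl rfl)) (Or.inr (Or.inr rfl)) ha hb⟩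
      · exact ⟨fun hb => hP x i j _ _ (Or.inr (Or.inr rfl)) (Or.inl rfl) ha hb,
          fun hb => hP x i j _ _ (Or.inr (Or.inr rfl)) (Or.inr (Or.inl rfl)) ha hb,
          fun hb => hP x i j _ _ (Or.inr (Or.inr rfl)) (Or.inr (Or.inr rfl)) ha hb⟩
    have hval : ∀ e : Edge d n, (e.1 = x ∨ e.1 = x.shift i ∨ e.1 = x.shift j) →
        U₁₂ e = U₁ e ∧ U₂ e = U e := by
      intro e he
      have hne : ¬ P₂ e.1 := by
        rcases he with he | he | he <;> rw [he]
        · exact hB.1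
        · exact hB.2.1
        · exact hB.2.2
      refine ⟨?_, h2 e hne⟩
      by_cases hp : P₁ e.1
      · exact h3 e hp
      · exact h42 e hp hne
    have e1 := hval (x, i) (Or.inl rfl)
    have e2 := hval (x.shift i, j) (Or.inr (Or.inl rfl))
    have e3 := hval (x.shift j, i) (Or.inr (Or.inr rfl))
    have e4 := hval (x, j) (Or.inl rfl)
    rw [spread_plaquetteHolonomy_congr (V := U₁₂) (W := U₁) e1.1 e2.1 e3.1 e4.1,
      spread_plaquetteHolonomy_congr (V := U₂) (W := U) e1.2 e2.2 e3.2 e4.2]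
    ring
  · -- no base site of the plaquette lies in `P₁`
    push Not at hA
    have hval : ∀ e : Edge d n, (e.1 = x ∨ e.1 = x.shift i ∨ e.1 = x.shift j) →
        U₁₂ e = U₂ e ∧ U₁ e = U e := by
      intro e he
      have hne : ¬ P₁ e.1 := by
        rcases he with he | he | he <;> rw [he]
        · exact hA.1
        · exact hA.2.1
        · exact hA.2.2
      exact ⟨h4 e hne, h1 e hne⟩
    have e1 := hval (x, i) (Or.inl rfl)
    have e2 := hval (x.shift i, j) (Or.inr (Or.inl rfl))
    have e3 := hval (x.shift j, i) (Or.inr (Or.inr rfl))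
    have e4 := hval (x, j) (Or.inl rfl)
    rw [spread_plaquetteHolonomy_congr (V := U₁₂) (W := U₂) e1.1 e2.1 e3.1 e4.1,
      spread_plaquetteHolonomy_congr (V := U₁) (W := U) e1.2 e2.2 e3.2 e4.2]
    ring

/-- The three base sites of a plaquette are `x + proj e` for lattice vectors `e` with entries in
`{0, 1}`. -/
theorem spread_baseSite_eq (x a : Site d n) (i j : Fin d)
    (ha : a = x ∨ a = x.shift i ∨ a = x.shift j) :
    ∃ e : Fin d → ℤ, (∀ k, 0 ≤ e k ∧ e k ≤ 1) ∧ a = x + Torus.proj n e := by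
  rcases ha with rfl | rfl | rfl
  · refine ⟨0, fun k => by simp, ?_⟩
    have : Torus.proj n (0 : Fin d → ℤ) = 0 := by funext k; simp [Torus.proj_apply]
    rw [this, add_zero]
  · refine ⟨Pi.single i 1, fun k => ?_, by rw [spread_proj_single]; rfl⟩
    by_cases h : k = i
    · subst h; simp
    · simp [h]
  · refine ⟨Pi.single j 1, fun k => ?_, by rw [spread_proj_single]; rfl⟩
    by_cases h : k = j
    · subst h; simp
    · simp [h]

end Wilson

/-- **Range-one locality of the Wilson action across separated boxes.** Let the boxes of radius
`R` about `c₁` and about `c₂` be `(2R+1+D)`-separated on the torus of side `n` (every periodic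
image), with `D ≥ 1`.  If `U₁` agrees with `U` off the image of box 1, `U₂` agrees with `U` off the
image of box 2, and `U₁₂` is `U₁` on the image of box 1 and `U₂` off it, then
`S_W(U₁₂) - S_W(U₁) - S_W(U₂) + S_W(U) = 0`: no plaquette has links based in both images
(the hypotheses are literally those of the line's `DetQuasilocal`). -/
theorem spread_wilsonAction_mixed_eq_zero :
    ∀ {d n N : ℕ} {G : Type*} [Group G] (ρ : G →* Matrix (Fin N) (Fin N) ℂ) [NeZero n] {R D : ℕ},
      1 ≤ D → ∀ {c₁ c₂ : Fin d → ℤ},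
      (∀ q : Fin d → ℤ, ∃ j : Fin d, ((2 * R + 1 + D : ℕ) : ℤ) ≤ |c₁ j - c₂ j - q j * n|) →
      ∀ (U U₁ U₂ U₁₂ : GaugeConfig d n G),
      (∀ e, (¬ ∃ y : ↥(box d R), Torus.proj n (c₁ + (y : Fin d → ℤ)) = e.1) → U₁ e = U e) →
      (∀ e, (¬ ∃ y : ↥(box d R), Torus.proj n (c₂ + (y : Fin d → ℤ)) = e.1) → U₂ e = U e) →
      (∀ e, (∃ y : ↥(box d R), Torus.proj n (c₁ + (y : Fin d → ℤ)) = e.1) → U₁₂ e = U₁ e) →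
      (∀ e, (¬ ∃ y : ↥(box d R), Torus.proj n (c₁ + (y : Fin d → ℤ)) = e.1) → U₁₂ e = U₂ e) →
      wilsonAction ρ U₁₂ - wilsonAction ρ U₁ - wilsonAction ρ U₂ + wilsonAction ρ U = 0 := by
  intro d n N G _ ρ _ R D hD c₁ c₂ hsep U U₁ U₂ U₁₂ h1 h2 h3 h4
  refine spread_wilsonAction_mixed_eq_zero_of_regions ρ
    (fun a => ∃ y : ↥(box d R), Torus.proj n (c₁ + (y : Fin d → ℤ)) = a)
    (fun a => ∃ y : ↥(box d R), Torus.proj n (c₂ + (y : Fin d → ℤ)) = a)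
    (fun x i j a b ha hb hPa hPb => ?_) U U₁ U₂ U₁₂ h1 h2 h3 h4
  obtain ⟨⟨y, hy⟩, hya⟩ := hPa
  obtain ⟨⟨y', hy'⟩, hyb⟩ := hPb
  obtain ⟨ea, hea, rfl⟩ := spread_baseSite_eq x a i j ha
  obtain ⟨eb, heb, rfl⟩ := spread_baseSite_eq x b i j hb
  refine spread_proj_add_sub_ne hsep hy hy' (e := ea - eb) (fun k => ?_) ?_
  · have h1 := hea k
    have h2 := heb k
    have : |ea k - eb k| ≤ 1 := by
      rw [abs_le]; constructor <;> omega
    exact this.trans (by exact_mod_cast hD)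
  · simp only at hya hyb
    rw [hya, hyb, spread_proj_sub]
    abel

end Summit.QuantumFields.QCD.Cruxes.WindowExtinction.FreeVolumeHeavyWitness

end
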